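import Summits.NavierStokesRegularity.NavierStokesRegularity.Theses.SlicedKelvin
import Literature.Analysis.FluidPDE.NSSuitableESSRefutation

/-!
# `PlanarFluxAPriori` is false without its energy-class hypotheses (plane Couette flow)

Negative-side support for the crux `SlicedKelvin.PlanarFluxAPriori` (stmt-NavierStokesRegularity-15600, route
`SlicedKelvin`, rank 2), refuter crux-attack seat, cycle 1 (2026-08-17). LOAD-BEARING ANALYSIS: the crux with its
two energy-class hypotheses — `IsLerayHopfOn T ν 0 (u 0) u` and `HasRapidSpatialDecay (u 0)` — DROPPED (keeping only
"classical solution of unforced Navier–Stokes on `[0,T)`") is FALSE (`planarFluxAPriori_false_without_energyClass`;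
the weakened statement is written INLINE). Witness: the stationary plane Couette flow `u(t, x) = x₀ e₁`, `p = 0`, an
entire classical solution for every viscosity (`∂ₜu = 0`, `(u·∇)u = L(Lx) = 0`, `Δu = 0`, `div u = tr L = 0`;
`isClassicalNSSolutionOn_clm_of_sq_eq_zero`), whose vorticity is the constant vector `e₂`, so the unsigned vorticity
flux through the coordinate plane `{x₂ = 0}` is `∫_{ℝ²} 1 = ∞` at every time.

CONSEQUENCES for provers: (i) any proof of the crux must use finite energy / spatial decay in a way that fails for
Couette-type (linear, non-decaying) fields — in the line `birth` this is exactly where `stub_heatKernelDomination` needs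
decay propagation to `t > 0`; (ii) the flux functional of the crux is honestly `ℝ≥0∞`-valued on classical solutions
(value `⊤` here), so the conclusion `∫⁻ … ≤ ENNReal.ofReal M` is not trivially true. The crux itself survives the
refuter's cheap attacks (elaborates; hypotheses satisfiable by the rest state; `simp`/`aesop`/`exact?` fail on it, on its
bare conclusion, and on both directions `PlanarFluxAPriori ↔ NavierStokesRegularity`).
-/

noncomputable section

namespace Summit.NavierStokesRegularity.NavierStokesRegularity.Theorems.PlanarFluxAPriori.Negative

open MeasureTheory Set Function Literature.Analysis.FluidPDE
open scoped Laplacian ContDiff ENNReal InnerProductSpace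

/-- **Nilpotent trace-free linear fields are stationary classical Navier–Stokes solutions.** For a continuous
linear `L : ℝ³ → ℝ³` with `L ∘ L = 0` and `div L = tr L = 0`, the stationary field `u(t, x) = L x` with zero
pressure solves the unforced system classically on every time set, for every viscosity (`∂ₜu = 0`,
`(u·∇)u = L(Lx) = 0`, `Δu = 0`; e.g. plane Couette flow; Majda–Bertozzi 2002, §1.2, exact linear solutions). [folklore] -/
theorem isClassicalNSSolutionOn_clm_of_sq_eq_zero
    {L : EuclideanSpace ℝ (Fin 3) →L[ℝ] EuclideanSpace ℝ (Fin 3)} (hL2 : ∀ x, L (L x) = 0)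
    (hdiv : ∀ x, VectorCalculus.divergence (L : EuclideanSpace ℝ (Fin 3) → EuclideanSpace ℝ (Fin 3)) x = 0)
    (S : Set ℝ) (ν : ℝ) :
    IsClassicalNSSolutionOn S ν 0 (fun _ : ℝ => (L : EuclideanSpace ℝ (Fin 3) → EuclideanSpace ℝ (Fin 3))) 0 where
  smooth_velocity := (contDiff_uncurry_const_clm L).contDiffOn
  smooth_pressure := by
    have h0 : uncurry (0 : ℝ → EuclideanSpace ℝ (Fin 3) → ℝ) = fun _ => 0 := rfl
    unfold IsSmoothSpaceTimeOn
    rw [h0]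
    exact contDiffOn_const
  momentum t _ x := by
    have h1 : timeDerivWithin S (fun _ : ℝ => (L : EuclideanSpace ℝ (Fin 3) → EuclideanSpace ℝ (Fin 3))) t x
        = 0 := by
      simp [timeDerivWithin]
    have h4 : gradient ((0 : ℝ → EuclideanSpace ℝ (Fin 3) → ℝ) t) x = 0 := by
      simp [Pi.zero_def]
    rw [h1, convect_clm_apply, laplacian_clm_apply, h4, hL2]
    simp
  divFree t _ := hdiv

/-- **`PlanarFluxAPriori` is false without its energy-class hypotheses.** The crux
`SlicedKelvin.PlanarFluxAPriori` with `IsLerayHopfOn T ν 0 (u 0) u` and `HasRapidSpatialDecay (u 0)` dropped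
(statement inline) fails: at the plane Couette flow `u = x₀ e₁` (`ν = T = 1`, `t = 0`, `R = id`, `c = 0`) the
vorticity is `e₂` and the unsigned flux is `∫⁻_{ℝ²} 1 = ⊤ ≰ ENNReal.ofReal M`. Hence every proof of the crux uses
finite energy / decay. [folklore] -/
theorem planarFluxAPriori_false_without_energyClass :
    ¬ (∀ (ν T : ℝ), 0 < ν → 0 < T →
        ∀ (u : ℝ → EuclideanSpace ℝ (Fin 3) → EuclideanSpace ℝ (Fin 3)) (p : ℝ → EuclideanSpace ℝ (Fin 3) → ℝ),
        IsClassicalNSSolutionOn (Set.Ico 0 T) ν 0 u p →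
        ∃ M : ℝ, ∀ t ∈ Set.Ico 0 T, ∀ (R : EuclideanSpace ℝ (Fin 3) ≃ₗᵢ[ℝ] EuclideanSpace ℝ (Fin 3)) (c : ℝ),
          ∫⁻ y : EuclideanSpace ℝ (Fin 2), ‖inner ℝ (curl (u t) (R (WithLp.toLp 2 ![y 0, y 1, c])))
            (R (EuclideanSpace.single 2 1))‖ₑ ≤ ENNReal.ofReal M) := by
  intro h
  -- the plane Couette shear `L x = x₀ e₁`
  set L : EuclideanSpace ℝ (Fin 3) →L[ℝ] EuclideanSpace ℝ (Fin 3) :=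
    (EuclideanSpace.proj (0 : Fin 3)).smulRight (EuclideanSpace.single (1 : Fin 3) (1 : ℝ)) with hL
  have hLx : ∀ x : EuclideanSpace ℝ (Fin 3), L x = x 0 • EuclideanSpace.single (1 : Fin 3) (1 : ℝ) :=
    fun x => rfl
  have hL2 : ∀ x, L (L x) = 0 := fun x => by
    rw [hLx, hLx, PiLp.smul_apply]
    simp
  have hdiv : ∀ x, VectorCalculus.divergence (L : EuclideanSpace ℝ (Fin 3) → EuclideanSpace ℝ (Fin 3)) x = 0 :=
    fun x => by
    rw [divergence_clm_apply, LinearMap.trace_eq_sum_inner _ (EuclideanSpace.basisFun (Fin 3) ℝ)]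
    simp [Fin.sum_univ_three, hLx, EuclideanSpace.inner_single_right]
  -- its vorticity has `e₂`-component `1` everywhere
  have hcurl : ∀ x, inner ℝ (curl (L : EuclideanSpace ℝ (Fin 3) → EuclideanSpace ℝ (Fin 3)) x)
      (EuclideanSpace.single (2 : Fin 3) (1 : ℝ)) = 1 := fun x => by
    simp [curl, ContinuousLinearMap.fderiv, hLx, EuclideanSpace.inner_single_right]
  obtain ⟨M, hM⟩ := h 1 1 one_pos one_pos (fun _ => (L : EuclideanSpace ℝ (Fin 3) → EuclideanSpace ℝ (Fin 3))) 0
    (isClassicalNSSolutionOn_clm_of_sq_eq_zero hL2 hdiv _ _)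
  have h0 := hM 0 ⟨le_rfl, one_pos⟩ (LinearIsometryEquiv.refl ℝ (EuclideanSpace ℝ (Fin 3))) 0
  have h1 : ∫⁻ _ : EuclideanSpace ℝ (Fin 2), ‖(1 : ℝ)‖ₑ = ⊤ := by
    rw [lintegral_const, measure_univ_of_isAddLeftInvariant, enorm_one, one_mul]
  simp only [LinearIsometryEquiv.coe_refl, id_eq, hcurl] at h0
  rw [h1] at h0
  exact ENNReal.ofReal_ne_top (top_le_iff.mp h0)

end Summit.NavierStokesRegularity.NavierStokesRegularity.Theorems.PlanarFluxAPriori.Negative
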